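import Mathlib.AlgebraicGeometry.Morphisms.Flat
import HarnessLib

/-!
# Global sections of a flat affine base change: `Γ(X ×_Y U) = Γ(U) ⊗_{Γ(V)} Γ(f⁻¹V)`

Topic: `Literature/AlgebraicGeometry/Resolution`. The ring of the base change `X ×_Y U → U` of a
quasi-compact quasi-separated `f : X → Y` along a flat `g : U → Y` from an AFFINE `U` mapping
into an affine open `V ⊆ Y` is the tensor product `Γ(U) ⊗_{Γ(Y, V)} Γ(X, f⁻¹V)` (flat base
change of `f_* 𝒪_X`, Stacks 02KH) — Mathlib's `isIso_pushoutSection_of_isQuasiSeparated_of_flat_right`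
repackaged as a ring isomorphism (`exists_ringEquiv_tensor_sections_pullback`), exactly as in
Mathlib's proof that relative normalization commutes with smooth base change (Stacks 03GV).
Used in de Jong 1996, 4.12 to compute `Γ(X'_U, 𝒪)` for an étale neighbourhood `U → ℙ^{d-1}`.
[folklore]; no definitions, no named facts.

## Sources

* The Stacks Project, Tag 02KH (flat base change), Tag 03GV. [StacksProject]
-/

noncomputable section

open CategoryTheory CategoryTheory.Limits AlgebraicGeometry TopologicalSpace TensorProduct

namespace Literature.AlgebraicGeometry.Resolution

universe u

/-- **`Γ(X ×_Y U, 𝒪) ≅ Γ(U) ⊗_{Γ(Y,V)} Γ(X, f⁻¹V)`** for `f : X → Y` quasi-compact and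
quasi-separated, `g : U → Y` flat from an affine `U` with `g(U) ⊆ V`, `V ⊆ Y` affine open; the
algebra structures are `f^♯ : Γ(Y, V) → Γ(X, f⁻¹V)` and `g^♯ : Γ(Y, V) → Γ(U)`, and the
isomorphism is the canonical map (pull back and multiply), so that it sends `r ⊗ 1` to
`pr_U^♯ r` and `1 ⊗ b` to `pr_X^♯ b`. [cite: StacksProject, Tag 02KH] -/
theorem exists_ringEquiv_tensor_sections_pullback {X Y U : Scheme.{u}} (f : X ⟶ Y)
    [QuasiCompact f] [QuasiSeparated f] (g : U ⟶ Y) [IsAffine U] [Flat g] {V : Y.Opens}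
    (hV : IsAffineOpen V) (hUV : (⊤ : U.Opens) ≤ g ⁻¹ᵁ V) :
    letI := (f.app V).hom.toAlgebra
    letI := (g.appLE V ⊤ hUV).hom.toAlgebra
    ∃ e : Γ(U, ⊤) ⊗[Γ(Y, V)] Γ(X, f ⁻¹ᵁ V) ≃+* Γ(pullback f g, pullback.snd f g ⁻¹ᵁ ⊤),
      (∀ r : Γ(U, ⊤), e (r ⊗ₜ 1) = (pullback.snd f g).app ⊤ r) ∧
      (∀ b : Γ(X, f ⁻¹ᵁ V), e (1 ⊗ₜ b) =
        (pullback.fst f g).appLE (f ⁻¹ᵁ V) (pullback.snd f g ⁻¹ᵁ ⊤)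
          (by rw [← Scheme.Hom.comp_preimage, pullback.condition, Scheme.Hom.comp_preimage]
              exact Scheme.Hom.preimage_mono _ hUV) b) := by
  have hUY : pullback.snd f g ⁻¹ᵁ ⊤ =
      pullback.fst f g ⁻¹ᵁ (f ⁻¹ᵁ V) ⊓ pullback.snd f g ⁻¹ᵁ ⊤ := by
    simp_rw [← Scheme.Hom.comp_preimage, pullback.condition, Scheme.Hom.comp_preimage,
      ← Scheme.Hom.preimage_inf, inf_eq_right.mpr hUV]
  have := isIso_pushoutSection_of_isQuasiSeparated_of_flat_right
    (.of_hasPullback f g) hUV le_rfl (UY := pullback.snd f g ⁻¹ᵁ ⊤) hUY hV (isAffineOpen_top U)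
    (f.isCompact_preimage hV.isCompact) (f.isQuasiSeparated_preimage hV.isQuasiSeparated)
  algebraize [(f.app V).hom, (g.appLE V ⊤ hUV).hom]
  let e₀ := (CommRingCat.isPushout_tensorProduct ..).flip.isoPushout ≪≫
    (pushout.congrHom f.app_eq_appLE rfl ≪≫ @asIso _ _ _ _ _ this :)
  refine ⟨e₀.commRingCatIsoToRingEquiv, fun r => ?_, fun b => ?_⟩
  · change (CommRingCat.ofHom (Algebra.TensorProduct.includeLeftRingHom
      (R := Γ(Y, V)) (A := Γ(U, ⊤)) (B := Γ(X, f ⁻¹ᵁ V))) ≫ e₀.hom) r = _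
    congr 2
    simp only [e₀, Iso.trans_hom, asIso_hom, IsPushout.inr_isoPushout_hom_assoc]
    change pushout.inr (f.app V) (g.appLE V ⊤ hUV) ≫ (pushout.congrHom _ _).hom ≫
      pushoutSection _ _ _ _ = _
    rw [pushout.congrHom_hom, pushout.inr_desc_assoc, Category.id_comp, pushout.inr_desc]
    exact (Scheme.Hom.app_eq_appLE _).symm
  · change (CommRingCat.ofHom (Algebra.TensorProduct.includeRight (R := Γ(Y, V))
      (A := Γ(U, ⊤)) (B := Γ(X, f ⁻¹ᵁ V))).toRingHom ≫ e₀.hom) b = _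
    congr 2
    simp only [e₀, Iso.trans_hom, asIso_hom, IsPushout.inl_isoPushout_hom_assoc]
    change pushout.inl (f.app V) (g.appLE V ⊤ hUV) ≫ (pushout.congrHom _ _).hom ≫
      pushoutSection _ _ _ _ = _
    rw [pushout.congrHom_hom, pushout.inl_desc_assoc, Category.id_comp, pushout.inl_desc]

end Literature.AlgebraicGeometry.Resolution

end
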